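import Summits.BirchSwinnertonDyer.BirchSwinnertonDyer.Theses.GenusKolyvaginAtTwo
import Summits.BirchSwinnertonDyer.BirchSwinnertonDyer.Theorems.GenusKolyvaginAtTwoMultiGenusPrimitivityAtTwoAuxiliaryFieldTwist

/-!
# Route `GenusKolyvaginAtTwo`, crux stmt-BirchSwinnertonDyer-24947 `MultiGenusPrimitivityAtTwo` (U): the crux BY NAME from the
# AUXILIARY-FIELD form (depth-2 prime level), via `…AuxiliaryFieldTwist` (p613997)

Lead prover seat bsd-line-gk2-p1 (g6). `…AuxiliaryFieldTwist` proves (`heegner_certificate_iff_auxField_of_card_selmerGroup_evenTwist_eq_one`)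
that on the crux's frame, at a depth-2 Kolyvagin prime `ℓ` whose EVEN genus twist `E^{(ℓ*·d_K)}` has `#Sel₂ = 1`, the crux's
certificate clause is EQUIVALENT to «no odd multiple of the reduced genus point `W_ℓ` is twice a `ℚ(θ_ℓ)`-rational point of
`E(K[ℓ])`». This file records the consequence for the item, in the manner of `…DepthLawOfReduced` (p608339): crux 24947 follows BY
NAME from its AUXILIARY-FIELD form «on the crux's frame SOME depth-2 Kolyvagin prime has a Sel₂-trivial even genus twist and a
`2`-primitive reduced genus point in the auxiliary quadratic field» — hypothesis `haux` below, binders = the crux's VERBATIM.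
CONDITIONAL on `haux` (the open kernel: W. Zhang's base case of Kolyvagin's conjecture at `p = 2` for the ODD genus twist
`E^{(ℓ*)}`, read in `E(ℚ(√ℓ*)) ⊗ ℤ₂`, plus the Mazur–Rubin supply of a prime with Sel₂-trivial even twist — crux memo
`Lines/genus-supply-local.md` §2/§4); the pointwise lemma serves the `DEF = 1` / ∃K re-typings alike. Helper
(`--supports stmt-BirchSwinnertonDyer-24947`); BSD is not proved by any of this.
-/

set_option linter.dupNamespace false -- tree convention: `Summit.BirchSwinnertonDyer.BirchSwinnertonDyer.Theorems` (summit = sub-problem)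

noncomputable section

open scoped Classical

namespace Summit.BirchSwinnertonDyer.BirchSwinnertonDyer.Theorems.GenusKoly

open Finset NumberField WeierstrassCurve Literature.NumberTheory.EllipticCurves
  Literature.NumberTheory.EllipticCurves.ModularForms

section Heegner

variable {W : WeierstrassCurve ℚ} [NeZero (W.conductorNorm ℤ)] {K : Type} [Field K] [NumberField K]
  {Dt : ModularParametrizationData W (W.conductorNorm ℤ)} {β : ℤ} {ι : K →+* ℂ}

/-- **Pointwise supply: the crux's certificate clause from the AUXILIARY-FIELD form.** On the crux's frame, if some prime
Kolyvagin level `ℓ` at `2` with `4 ∣ a_ℓ` carries: radicals, an enumeration `G` of `Gal(K[ℓ]/K)`, a square root `√d ∈ K ∖ ℚ`, an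
elliptic model `Wd` of the even genus twist `W^{(ℓ*·d)}` with `#Sel₂(Wd) = 1`, and a reduced genus point `W_ℓ` (`2·W_ℓ = Y_ℓ`) NO odd
multiple of which is twice a `ℚ(θ_ℓ)`-rational point — then the crux's `∃ (n, d, θ, T)`-clause holds (with `n = ℓ`,
`T = {g ∈ G : gθ_ℓ = θ_ℓ}`). [cite: GrossLMS1991, §3 (3.5), Prop. 3.7 (1), §4 (4.1), Lemma 4.3, §5] [cite: Cox2013, §9.A Lemma 9.3]
[cite: SilvermanAEC2009, X.2 Prop. 2.4, X.4.2, VIII.6.7] -/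
theorem heegner_exists_multiGenusCertificate_of_auxFieldPrimitive [W.IsElliptic] [W.IsGloballyMinimal]
    (hK : IsImaginaryQuadratic K) (hodd : Odd (NumberField.discr K)) (h3 : NumberField.discr K ≠ -3)
    (hH : SatisfiesHeegnerHypothesis (W.conductorNorm ℤ) K) (hsurj : W.HasSurjectiveModNGaloisRep ((2 : ℤ) ^ 1))
    (haux : ∃ (ℓ : ℕ) (d : KolyvaginHeegnerData Dt β ι ℓ) (θ : ℕ → ringClassField K ι ℓ)
      (G : Finset (ringClassField K ι ℓ ≃ₐ[ℚ] ringClassField K ι ℓ))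
      (Wn : (W.baseChange (ringClassField K ι ℓ)).toAffine.Point) (s₀ : K) (dK : ℚ)
      (Wd : WeierstrassCurve ℚ) (_ : Wd.IsElliptic),
      ℓ.Prime ∧ (∀ ℓ' ∈ ℓ.primeFactors, Zhang2014.IsKolyvaginPrime (W.conductorNorm ℤ) W K 2 ℓ') ∧
      (∀ ℓ' ∈ ℓ.primeFactors, (4 : ℤ) ∣ W.frobeniusTrace ℓ') ∧
      (∀ ℓ' ∈ ℓ.primeFactors, θ ℓ' ^ 2 = algebraMap ℚ (ringClassField K ι ℓ) ((-1 : ℚ) ^ (ℓ' / 2) * ℓ')) ∧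
      (∀ g, g ∈ G ↔ g ∈ ringClassGal ι ℓ) ∧
      s₀ ∉ Set.range (algebraMap ℚ K) ∧ s₀ ^ 2 = algebraMap ℚ K dK ∧
      (∃ C : WeierstrassCurve.VariableChange ℚ, C • W.quadraticTwist (((-1 : ℚ) ^ (ℓ / 2) * ℓ) * dK) = Wd) ∧
      Nat.card (Wd.selmerGroup 2) = 1 ∧
      ((2 : ℤ) ^ ℓ.primeFactors.card) • Wn =
        ∑ g ∈ G, (∏ ℓ' ∈ ℓ.primeFactors, (if g (θ ℓ') = θ ℓ' then (1 : ℤ) else -1)) •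
          pointGalHom W (ringClassField K ι ℓ) g d.y ∧
      ∀ m : ℕ, Odd m → ¬ ∃ Q : (W.baseChange (ringClassField K ι ℓ)).toAffine.Point,
        (∀ g : ringClassField K ι ℓ ≃ₐ[ℚ] ringClassField K ι ℓ, g (θ ℓ) = θ ℓ →
          pointGalHom W (ringClassField K ι ℓ) g Q = Q) ∧ (2 : ℤ) • Q = (m : ℤ) • Wn) :
    ∃ (n : ℕ) (d : KolyvaginHeegnerData Dt β ι n) (θ : ℕ → ringClassField K ι n)
      (T : Finset (ringClassField K ι n ≃ₐ[ℚ] ringClassField K ι n)),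
      Squarefree n ∧ (∀ ℓ ∈ n.primeFactors, Zhang2014.IsKolyvaginPrime (W.conductorNorm ℤ) W K 2 ℓ) ∧
      (∀ ℓ ∈ n.primeFactors, θ ℓ ^ 2 = algebraMap ℚ (ringClassField K ι n) ((-1 : ℚ) ^ (ℓ / 2) * ℓ)) ∧
      (∀ g, g ∈ T ↔ g ∈ ringClassGal ι n ∧ ∀ ℓ ∈ n.primeFactors, g (θ ℓ) = θ ℓ) ∧
      ¬ ∃ Q : (W.baseChange (ringClassField K ι n)).toAffine.Point, (2 : ℤ) • Q =
        ∑ g ∈ T, pointGalHom W (ringClassField K ι n) g d.y := by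
  obtain ⟨ℓ, d, θ, G, Wn, s₀, dK, Wd, _, hℓ, hKoly, hfour, hθ, hG, hs₀, hs₀2, hC, hSel, hWn, hprim⟩ := haux
  refine ⟨ℓ, d, θ, G.filter (fun g ↦ ∀ ℓ' ∈ ℓ.primeFactors, g (θ ℓ') = θ ℓ'), Irreducible.squarefree hℓ, hKoly, hθ,
    fun g ↦ by rw [Finset.mem_filter, hG], ?_⟩
  exact (heegner_certificate_iff_auxField_of_card_selmerGroup_evenTwist_eq_one hK hodd h3 hH hsurj hℓ hKoly hfour d hθ G hG _
    (fun g ↦ by rw [Finset.mem_filter, hG]) hs₀ hs₀2 Wd hC hSel hWn).mpr hprim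

end Heegner

/-! ## Crux 24947 BY NAME from the auxiliary-field form -/

section Crux

open Summit.BirchSwinnertonDyer.BirchSwinnertonDyer.Theses.GenusKolyvaginAtTwo

/-- **`MultiGenusPrimitivityAtTwo` (crux 24947) from «some depth-2 Kolyvagin prime has a Sel₂-trivial even genus twist and a
`2`-primitive reduced genus point in the auxiliary field `ℚ(√ℓ*)`».** The hypothesis is the crux's own binder list VERBATIM up to
(and including) the twin clause, concluding with the auxiliary-field data of
`heegner_exists_multiGenusCertificate_of_auxFieldPrimitive`. CONDITIONAL on that hypothesis (the open kernel, read in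
`E(ℚ(√ℓ*)) ⊗ ℤ₂`: W. Zhang's base case of Kolyvagin's conjecture at `p = 2` for the odd genus twist, plus the Mazur–Rubin supply of
a prime whose even genus twist is Sel₂-trivial); nothing else. [cite: GrossLMS1991, §3 (3.5), Prop. 3.7 (1), §4 (4.1), Lemma 4.3, §5]
[cite: WZhang2014, Thm. 1.1 (the p ≥ 5 prototype)] [cite: MazurRubin2010, Prop. 5.2] -/
theorem multiGenusPrimitivityAtTwo_of_auxFieldPrimitive
    (haux : ∀ (W : WeierstrassCurve ℚ) [W.IsElliptic] [W.IsGloballyMinimal] [NeZero (W.conductorNorm ℤ)], ¬ W.HasCM →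
      W.analyticRank = 0 → (∀ n : ℕ, 0 < n → W.HasSurjectiveModNGaloisRep ((2 : ℤ) ^ n)) → Odd W.tamagawaProduct →
      ∀ (K : Type) [Field K] [NumberField K], Literature.NumberTheory.EllipticCurves.IsImaginaryQuadratic K →
      Odd (NumberField.discr K) → NumberField.discr K ≠ -3 →
      Literature.NumberTheory.EllipticCurves.SatisfiesHeegnerHypothesis (W.conductorNorm ℤ) K →
      ¬ IsSquare ((NumberField.discr K : ℚ) * -|W.Δ|) → ¬ IsSquare ((NumberField.discr K : ℚ) * (-(2 * |W.Δ|))) →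
      ∀ (Dt : Literature.NumberTheory.EllipticCurves.ModularForms.ModularParametrizationData W (W.conductorNorm ℤ)),
      (∀ z ∈ Dt.L.lattice, ∃ w ∈ Literature.NumberTheory.EllipticCurves.ModularForms.periodLattice Dt.f, z = (Dt.c : ℂ) * w) →
      Odd Dt.c → ∀ (β : ℤ) (ι : K →+* ℂ) (d₁ : Literature.NumberTheory.EllipticCurves.KolyvaginHeegnerData Dt β ι 1),
      ¬ IsOfFinAddOrder d₁.derivedPoint → ∀ (Wd : WeierstrassCurve ℚ) [Wd.IsElliptic] [Wd.IsGloballyMinimal],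
      (∃ C : WeierstrassCurve.VariableChange ℚ, C • W.quadraticTwist (NumberField.discr K : ℚ) = Wd) → Wd.analyticRank = 1 →
      Nat.card (Wd.selmerGroup 2) = 2 →
      ∃ (ℓ : ℕ) (d : Literature.NumberTheory.EllipticCurves.KolyvaginHeegnerData Dt β ι ℓ)
        (θ : ℕ → Literature.NumberTheory.EllipticCurves.ringClassField K ι ℓ)
        (G : Finset (Literature.NumberTheory.EllipticCurves.ringClassField K ι ℓ ≃ₐ[ℚ]
          Literature.NumberTheory.EllipticCurves.ringClassField K ι ℓ))
        (Wn : (W.baseChange (Literature.NumberTheory.EllipticCurves.ringClassField K ι ℓ)).toAffine.Point)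
        (s₀ : K) (dK : ℚ) (We : WeierstrassCurve ℚ) (_ : We.IsElliptic),
        ℓ.Prime ∧
        (∀ ℓ' ∈ ℓ.primeFactors, Literature.NumberTheory.EllipticCurves.Zhang2014.IsKolyvaginPrime (W.conductorNorm ℤ) W K 2 ℓ') ∧
        (∀ ℓ' ∈ ℓ.primeFactors, (4 : ℤ) ∣ W.frobeniusTrace ℓ') ∧
        (∀ ℓ' ∈ ℓ.primeFactors, θ ℓ' ^ 2 =
          algebraMap ℚ (Literature.NumberTheory.EllipticCurves.ringClassField K ι ℓ) ((-1 : ℚ) ^ (ℓ' / 2) * ℓ')) ∧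
        (∀ g, g ∈ G ↔ g ∈ Literature.NumberTheory.EllipticCurves.ringClassGal ι ℓ) ∧
        s₀ ∉ Set.range (algebraMap ℚ K) ∧ s₀ ^ 2 = algebraMap ℚ K dK ∧
        (∃ C : WeierstrassCurve.VariableChange ℚ, C • W.quadraticTwist (((-1 : ℚ) ^ (ℓ / 2) * ℓ) * dK) = We) ∧
        Nat.card (We.selmerGroup 2) = 1 ∧
        ((2 : ℤ) ^ ℓ.primeFactors.card) • Wn =
          ∑ g ∈ G, (∏ ℓ' ∈ ℓ.primeFactors, (if g (θ ℓ') = θ ℓ' then (1 : ℤ) else -1)) •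
            Literature.NumberTheory.EllipticCurves.pointGalHom W
              (Literature.NumberTheory.EllipticCurves.ringClassField K ι ℓ) g d.y ∧
        ∀ m : ℕ, Odd m →
          ¬ ∃ Q : (W.baseChange (Literature.NumberTheory.EllipticCurves.ringClassField K ι ℓ)).toAffine.Point,
            (∀ g : Literature.NumberTheory.EllipticCurves.ringClassField K ι ℓ ≃ₐ[ℚ]
                Literature.NumberTheory.EllipticCurves.ringClassField K ι ℓ, g (θ ℓ) = θ ℓ →
              Literature.NumberTheory.EllipticCurves.pointGalHom W
                (Literature.NumberTheory.EllipticCurves.ringClassField K ι ℓ) g Q = Q) ∧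
            (2 : ℤ) • Q = (m : ℤ) • Wn) :
    MultiGenusPrimitivityAtTwo := by
  intro W _ _ _ hcm hr0 hρ hT K _ _ hIQ hodd h3 hHe hsq1 hsq2 Dt hopt hc β ι d₁ hy Wd _ _ hWd hrd hSel
  have hsurj : W.HasSurjectiveModNGaloisRep ((2 : ℤ) ^ 1) := hρ 1 one_pos
  exact heegner_exists_multiGenusCertificate_of_auxFieldPrimitive hIQ hodd h3 hHe hsurj
    (haux W hcm hr0 hρ hT K hIQ hodd h3 hHe hsq1 hsq2 Dt hopt hc β ι d₁ hy Wd hWd hrd hSel)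

end Crux

end Summit.BirchSwinnertonDyer.BirchSwinnertonDyer.Theorems.GenusKoly

end
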